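import Summits.HodgeConjecture.HodgeConjecture.Theorems.Q8SymplecticPowersCertifiedDeckFamilyOfMember
import Summits.HodgeConjecture.HodgeConjecture.Theorems.Q8MonodromyBireflectionAssemblyKer
import Summits.HodgeConjecture.HodgeConjecture.Theorems.Q8MonodromyBireflectionLocalConfiguration
import HarnessLib

/-!
# Route `Q8SymplecticPowers`, crux K1Q (stmt-HodgeConjecture-24190), line `mechanism-v2`, skeleton v12:
# the S9 single-member assembly with the S5 input in the CORRECTED two-ball currency (`γ ≠ 1` on `ker(A² + 1)`)

Cell `hodge-nonav`, prover seat `hodge-nonav-20241-p1` (g23); target named by the pen-holder p3 g38 (STATUS 2026-08-29T16:01:33Z).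
HELPER FILE (`--supports stmt-HodgeConjecture-24190 --as helper`; nothing here closes a registered stub or an item). Sorry-free,
axioms standard, no definition, no new named fact.

Skeleton v12 (`K1Q_mechanism_v12.lean`, sha256 `124c8841…9119`) registers the deciding content of K1Q as the member-level data stubs
`stub_memberDataQ4P` ∕ `stub_memberDataQge6P : ‹S8 print packet› → H`, where `H` = «∃ a deck-family package with the fifteen S6
clauses, ∀ `hU`, ∃ ONE member `s₀` carrying (a) the Hodge counts (o)(o′), (b) the monodromy clauses (ii)((iii))(iv) on `Miv`, and
(c) the S5-v6 bireflection clause» — the hypothesis of `stub_certifiedDeckFamilyQ4_of_member` (prover 19716-p2, p730189). The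
geometric source of conjunct (c) is prover-Ax's LOC6 two-ball datum. Its first consumer `certifiedDeckFamily_clauses_of_twoBallDatum`
(p730189) goes through `monodromyBireflection_of_twoBallDatum_of_ne_one` (p729438), which asks `γ ≠ 1` on all of `H²` and the
variation inclusion `h_* y − y ∈ W₁ + W₂` for EVERY `y ∈ H₂`. Prover-Ax's finding (STATUS 16:02Z, after the review of p729611): the
ball pieces at the `d6` points contain the exceptional curves `E±` of the member, which the monodromy swaps, so the variation
inclusion can only be expected — and `γ ≠ 1` must be asked — on the `τ² = −1` part; the corrected assembly is
`monodromyBireflection_of_twoBallDatum_of_ne_one_ker` (p730506). This file re-routes the single-member assembly through it: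

* `monodromyBireflection_at_member_of_twoBallDatum_ker` — conjunct (c) of `H` at the member `s₀` ALONE from the corrected datum
  (any smooth projective deck family `π` with `τ⁴ = 1`, `j² = τ²`, `τ j τ = j` over any quasi-projective base; Poincaré duality of
  `X_{s₀}(ℂ)` discharged by `bijective_poincareDualityMap_complexOrientationRat_two`, p727839) — the term a closer of
  `stub_memberDataQ4P` ∕ `stub_memberDataQge6P` puts in the third slot of `⟨s₀, ‹counts›, ‹(ii)((iii))(iv)›, ‹(c)›⟩`;
* `certifiedDeckFamily_clauses_of_twoBallDatum_ker` — `certifiedDeckFamily_clauses_of_twoBallDatum` (p730189) VERBATIM except for the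
  two corrected binders: `γ ≠ 1` ↦ `∃ a, A (A a) = −a ∧ γ a ≠ a`, and the unrestricted variation hypothesis dropped (the one on
  `ker(τ_*² + 1)` kept); conclusion = `(∀ s, S4-v6 body) ∧ (∀ s, S5-v6 body)` token-equal to the bodies of the v10 ∕ v12 stubs;
* `certifiedDeckFamily_clauses_of_localConfiguration` (§ appended once p730948 landed) — the same with the S5 input one step further
  upstream: prover-Ax's LOCAL CONFIGURATION of a monodromy homeomorphism at `s₀` (open pieces `A₁, A₂, B` of `X_{s₀}(ℂ)` and the
  homological identities on the `τ|² = −1` part of `H₂(A_k; ℚ)`; `monodromyBireflection_of_localConfiguration`, p730948).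

HONEST FRAMING: composition only; the datum itself (LOC6: LocalConfiguration v2 + L6-2 + L6-4a at one member) is NOT constructed here;
S9, K1Q, HC, HC_AV are NOT proved and no rung moves.

References: C. Voisin, *Hodge Theory and Complex Algebraic Geometry II* (CUP 2003) §3.1.2, §3.2.1 (monodromy, Picard–Lefschetz);
A. Hatcher, *Algebraic Topology* (CUP 2002) §3.3 Thm. 3.30 (Poincaré duality).
-/

noncomputable section

set_option linter.dupNamespace false
set_option maxHeartbeats 800000

namespace Summit.HodgeConjecture.HodgeConjecture.Theorems.Q8SymplecticPowersCertifiedDeckFamilyOfKerDatum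

open scoped TensorProduct
open Summit.HodgeConjecture.HodgeConjecture.Theorems.Q8SymplecticPowersCertifiedDeckFamilyOfMember
open Summit.HodgeConjecture.HodgeConjecture.Theorems.Q8MonodromyBireflectionAssembly
open CategoryTheory CategoryTheory.Limits AlgebraicGeometry
open Literature.AlgebraicGeometry.Motives Literature.AlgebraicGeometry.HodgeTheory
open Literature.AlgebraicGeometry.HodgeTheory.BettiUniverse Literature.AlgebraicGeometry.HodgeTheory.Q8Family
open Literature.AlgebraicTopology.SingularHomology

/-- **Conjunct (c) of the member-level data at `s₀` from the corrected two-ball datum.** For a smooth projective deck family `π`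
(`τ⁴ = 1`, `j² = τ²`, `τ j τ = j`) over a quasi-projective base and a member `s₀`: a monodromy transformation `γ ∈ Γ_{s₀}` moving
some `a₀ ∈ ker(A² + 1)`, realised by a homeomorphism `h` of `X_{s₀}(ℂ)` fixing the fundamental class, with a homological two-ball
datum `W₁, W₂ ≤ H₂(X_{s₀}(ℂ); ℚ)` (`dim W₁ ≤ 2`, τ-stable with `τ² = −1`, exchanged by `j`, variation of `h` on `ker(τ_*² + 1)` inside
`W₁ + W₂`, `h = τ` on `W₁`, `hτ = 1` on `W₂`, Poincaré-dual carriers `Qf`-orthogonal) yields the S5-v6 bireflection clause at `s₀`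
(prover-Ax's `monodromyBireflection_of_twoBallDatum_of_ne_one_ker`, Poincaré duality discharged).
[cite: VoisinHodgeII2003, §3.1.2 and §3.2.1] [cite: HatcherAT2002, §3.3 Thm. 3.30] -/
theorem monodromyBireflection_at_member_of_twoBallDatum_ker :
    open Literature.AlgebraicGeometry.Motives Literature.AlgebraicGeometry.HodgeTheory Literature.AlgebraicGeometry.HodgeTheory.BettiUniverse Literature.AlgebraicGeometry.HodgeTheory.Q8Family Literature.AlgebraicGeometry.RelativeSpec Literature.AlgebraicGeometry.RelativeSpec.ActionOver CategoryTheory CategoryTheory.Limits MonoidalCategory CartesianMonoidalCategory AlgebraicGeometry in ∀ {𝒳 S : SchemeOver ℂ} (π : 𝒳 ⟶ S) (τ j : 𝒳 ⟶ 𝒳) (hπ : IsSmoothProjectiveFamily π 2), IsQuasiProjectiveOver 𝒳 → IsQuasiProjectiveOver S → ∀ (hτπ : τ ≫ π = π) (hjπ : j ≫ π = π), τ ≫ τ ≫ τ ≫ τ = 𝟙 𝒳 → j ≫ j = τ ≫ τ → τ ≫ j ≫ τ = j → ∀ (hU : IsCohomologicallyLocallyTrivialOn π Set.univ) (s₀ :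 ComplexPoints S), ∀ (γ : bettiCohomology (fiberOver π s₀) 2 ≃ₗ[ℚ] bettiCohomology (fiberOver π s₀) 2), γ ∈ ratMonodromyGroup π 2 hU ⟨s₀, Set.mem_univ s₀⟩ → (∃ a, pull (fiberOverEnd π τ hτπ s₀) 2 (pull (fiberOverEnd π τ hτπ s₀) 2 a) = -a ∧ γ a ≠ a) → ∀ (h : ComplexPoints (fiberOver π s₀) ≃ₜ ComplexPoints (fiberOver π s₀)), (∀ a, γ a = (singularCohomology.map ℚ ℚ (h : C(ComplexPoints (fiberOver π s₀), ComplexPoints (fiberOver π s₀))) 2).hom a) → singularHomology.map ℚ ℚ (h : C(ComplexPoints (fiberOver π s₀), ComplexPoints (fiberOver π s₀))) 4 (complexOrientationRat (hπ.isSmoothProjective s₀)).fundamentalClass = (complexOrientationRat (hπ.isSmoothProjective s₀)).fundamentalClass → ∀ (W₁ W₂ : Submodule ℚ (singularHomology ℚ ℚ (ComplexPoints (fiberOver π s₀)) 2)), Module.finrank ℚ W₁ ≤ 2 → (∀ w ∈ W₁, singularHomology.map ℚ ℚ (AlgPoints.mapContinuous (L := ℂ) (fiberOverEnd π τ hτπ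 s₀)) 2 w ∈ W₁) → (∀ w ∈ W₂, singularHomology.map ℚ ℚ (AlgPoints.mapContinuous (L := ℂ) (fiberOverEnd π τ hτπ s₀)) 2 w ∈ W₂) → (∀ w ∈ W₁, singularHomology.map ℚ ℚ (AlgPoints.mapContinuous (L := ℂ) (fiberOverEnd π τ hτπ s₀)) 2 (singularHomology.map ℚ ℚ (AlgPoints.mapContinuous (L := ℂ) (fiberOverEnd π τ hτπ s₀)) 2 w) = -w) → (∀ w ∈ W₂, singularHomology.map ℚ ℚ (AlgPoints.mapContinuous (L := ℂ) (fiberOverEnd π τ hτπ s₀)) 2 (singularHomology.map ℚ ℚ (AlgPoints.mapContinuous (L := ℂ) (fiberOverEnd π τ hτπ s₀)) 2 w) = -w) → (∀ w ∈ W₁, singularHomology.map ℚ ℚ (AlgPoints.mapContinuous (L := ℂ) (fiberOverEnd π j hjπ s₀)) 2 w ∈ W₂) → (∀ w ∈ W₂, singularHomology.map ℚ ℚ (AlgPoints.mapContinuous (L := ℂ) (fiberOverEnd π j hjπ s₀)) 2 w ∈ W₁) → (∀ y, singularHomology.map ℚ ℚ (AlgPoints.mapContinuous (L := ℂ) (fiberOverEnd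 π τ hτπ s₀)) 2 (singularHomology.map ℚ ℚ (AlgPoints.mapContinuous (L := ℂ) (fiberOverEnd π τ hτπ s₀)) 2 y) = -y → singularHomology.map ℚ ℚ (h : C(ComplexPoints (fiberOver π s₀), ComplexPoints (fiberOver π s₀))) 2 y - y ∈ W₁ ⊔ W₂) → (∀ w ∈ W₁, singularHomology.map ℚ ℚ (h : C(ComplexPoints (fiberOver π s₀), ComplexPoints (fiberOver π s₀))) 2 w = singularHomology.map ℚ ℚ (AlgPoints.mapContinuous (L := ℂ) (fiberOverEnd π τ hτπ s₀)) 2 w) → (∀ w ∈ W₂, singularHomology.map ℚ ℚ (h : C(ComplexPoints (fiberOver π s₀), ComplexPoints (fiberOver π s₀))) 2 (singularHomology.map ℚ ℚ (AlgPoints.mapContinuous (L := ℂ) (fiberOverEnd π τ hτπ s₀)) 2 w) = w) → (∀ a b, poincareDualityMap (n := 4) (complexOrientationRat (hπ.isSmoothProjective s₀)) (show 2 + 2 = 4 by norm_num) a ∈ W₁ → poincareDualityMap (n := 4) (complexOrientationRat (hπ.isSmoothProjective s₀)) (show 2 + 2 = 4 by norm_num) b ∈ W₂ → tr (hπ.isSmoothProjective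 s₀) (2 + 2) (cup (fiberOver π s₀) 2 2 a b) = 0) → (let Xs := fiberOver π s₀; let hXs : IsSmoothProjective 2 Xs := hπ.isSmoothProjective s₀; let A : bettiCohomology Xs 2 →ₗ[ℚ] bettiCohomology Xs 2 := pull (fiberOverEnd π τ hτπ s₀) 2; let B : bettiCohomology Xs 2 →ₗ[ℚ] bettiCohomology Xs 2 := pull (fiberOverEnd π j hjπ s₀) 2; let Qf : LinearMap.BilinForm ℚ (bettiCohomology Xs 2) := LinearMap.compr₂ (cup Xs 2 2) (tr hXs (2 + 2)); let Γ := ratMonodromyGroup π 2 hU ⟨s₀, Set.mem_univ s₀⟩; ∃ γ ∈ Γ, ∃ ℓp ℓm : TensorProduct ℚ ℂ (bettiCohomology Xs 2), ℓp ∈ (Module.End.eigenspace (A ^ 2) (-1)).baseChange ℂ ∧ ℓm ∈ (Module.End.eigenspace (A ^ 2) (-1)).baseChange ℂ ∧ A.baseChange ℂ ℓp = Complex.I • ℓp ∧ A.baseChange ℂ ℓm = Complex.I • ℓm ∧ (Qf.baseChange ℂ) ℓp (B.baseChange ℂ ℓm) ≠ 0 ∧ (γ.toLinearMap.baseChange ℂ)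 ℓp = Complex.I • ℓp ∧ (γ.toLinearMap.baseChange ℂ) ℓm = (-Complex.I) • ℓm ∧ ∀ x ∈ (Module.End.eigenspace (A ^ 2) (-1)).baseChange ℂ, A.baseChange ℂ x = Complex.I • x → (Qf.baseChange ℂ) x (B.baseChange ℂ ℓp) = 0 → (Qf.baseChange ℂ) x (B.baseChange ℂ ℓm) = 0 → (γ.toLinearMap.baseChange ℂ) x = x) := by
  intro 𝒳 S π τ j hπ hqp hqpS hτπ hjπ hτ4 hj2 hτjτ hU s₀ γ hγΓ hγ1 h hγh hhμ W₁ W₂ hW₁ htW₁ htW₂ htt₁ htt₂ hjW₁ hjW₂ hvar hh₁ hh₂ horth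
  exact monodromyBireflection_of_twoBallDatum_of_ne_one_ker π hτπ hπ hqp hqpS hjπ hτ4 hj2 hτjτ hU s₀ γ hγΓ hγ1 h hγh hhμ
    (bijective_poincareDualityMap_complexOrientationRat_two (hπ.isSmoothProjective s₀)) W₁ W₂ hW₁ htW₁ htW₂ htt₁ htt₂ hjW₁ hjW₂
    hvar hh₁ hh₂ horth

/-- **S9 from ONE member, the S5 input in the CORRECTED geometric form.** As `certifiedDeckFamily_clauses_of_twoBallDatum` (p730189):
for every even `e ≥ 4`, every deck-family package of S6 (the binders of the v10 ∕ v12 stubs), `hU` and ONE member `s₀`, the Hodge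
counts (o)(o′) at `s₀`, the monodromy clauses (ii)((iii))(iv) at `s₀`, and the corrected two-ball datum at `s₀` (`γ a₀ ≠ a₀` for one
`a₀ ∈ ker(A² + 1)`; variation inclusion on `ker(τ_*² + 1)` only) imply the S4-v6 body AND the S5-v6 body at EVERY member.
Proof: `monodromyBireflection_at_member_of_twoBallDatum_ker`, then `certifiedDeckFamily_clauses_of_member` ((B′) + (ε)).
[cite: VoisinHodgeII2003, §3.1.2 and §3.2.1] [cite: VoisinHodgeI2002, §9.3.1 Prop. 9.20] -/
theorem certifiedDeckFamily_clauses_of_twoBallDatum_ker :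
    open Literature.AlgebraicGeometry.Motives Literature.AlgebraicGeometry.HodgeTheory Literature.AlgebraicGeometry.HodgeTheory.BettiUniverse Literature.AlgebraicGeometry.HodgeTheory.Q8Family Literature.AlgebraicGeometry.RelativeSpec Literature.AlgebraicGeometry.RelativeSpec.ActionOver CategoryTheory CategoryTheory.Limits MonoidalCategory CartesianMonoidalCategory AlgebraicGeometry in ∀ ⦃e : ℕ⦄, Even e → 4 ≤ e → ∀ (W : (Spec (.of (ParamRing e))).Opens) (𝒳 : SchemeOver ℂ) (π : 𝒳 ⟶ base W) (τ j : 𝒳 ⟶ 𝒳) (ι : (deckChart (fun i => (MvPolynomial.X i : ParamRing e)) ⊗ Over.mk W.ι).left ⟶ 𝒳.left), Nonempty (ComplexPoints (base W)) → ∀ (hπ : IsSmoothProjectiveFamily π 2), IsQuasiProjectiveOver 𝒳 → IsQuasiProjectiveOver (base W) → AlgebraicGeometry.SmoothOfRelativeDimension (Fintype.card (CIdx e)) (base W).hom → ∀ (hτπ : τ ≫ π = π) (hjπ : j ≫ π = π), τ ≫ τ ≫ τ ≫ τ = 𝟙 𝒳 → j ≫ j = τ ≫ τ → τ ≫ j ≫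 τ = j → IsOpenImmersion ι → ι ≫ π.left = (snd (deckChart (fun i => (MvPolynomial.X i : ParamRing e))) (Over.mk W.ι)).left → ((Over.isoMk ((deckAction (fun i => (MvPolynomial.X i : ParamRing e))).aut (QuaternionGroup.a 1)) ((deckAction (fun i => (MvPolynomial.X i : ParamRing e))).aut_comp (QuaternionGroup.a 1))).hom ▷ Over.mk W.ι).left ≫ ι = ι ≫ τ.left → ((Over.isoMk ((deckAction (fun i => (MvPolynomial.X i : ParamRing e))).aut (QuaternionGroup.xa 0)) ((deckAction (fun i => (MvPolynomial.X i : ParamRing e))).aut_comp (QuaternionGroup.xa 0))).hom ▷ Over.mk W.ι).left ≫ ι = ι ≫ j.left → Function.Surjective (snd (deckChart (fun i => (MvPolynomial.X i : ParamRing e))) (Over.mk W.ι)).left → ∀ (hU : IsCohomologicallyLocallyTrivialOn π Set.univ) (s₀ : ComplexPoints (base W)), (let Xs := fiberOver π s₀; let hXs : IsSmoothProjective 2 Xs := hπ.isSmoothProjective s₀; let A : bettiCohomology Xs 2 →ₗ[ℚ] bettiCohomology Xs 2 := pull (fiberOverEnd π τ hτπ s₀) 2; Module.finrank ℂ ↥(Module.End.eigenspace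 ((A ^ 2).baseChange ℂ) 1 ⊓ (hodge exists_isReal_hodgeModel_holds hXs 2).piece 2 0) = 0 ∧ 0 < Module.finrank ℂ ↥(Module.End.eigenspace ((A ^ 2).baseChange ℂ) (-1) ⊓ (hodge exists_isReal_hodgeModel_holds hXs 2).piece 2 0)) → (let Xs := fiberOver π s₀; let hXs : IsSmoothProjective 2 Xs := hπ.isSmoothProjective s₀; let A : bettiCohomology Xs 2 →ₗ[ℚ] bettiCohomology Xs 2 := pull (fiberOverEnd π τ hτπ s₀) 2; let Qf : LinearMap.BilinForm ℚ (bettiCohomology Xs 2) := LinearMap.compr₂ (cup Xs 2 2) (tr hXs (2 + 2)); let Γ := ratMonodromyGroup π 2 hU ⟨s₀, Set.mem_univ s₀⟩; let N : Submodule ℚ (bettiCohomology Xs 2) := Submodule.span ℚ {x | ∃ Γ' : Subgroup (bettiCohomology Xs 2 ≃ₗ[ℚ] bettiCohomology Xs 2), Γ' ≤ Γ ∧ (Γ'.subgroupOf Γ).FiniteIndex ∧ ∀ γ ∈ Γ', γ x = x}; let Mv : Submodule ℚ (bettiCohomology Xs 2) := Module.End.eigenspace (A ^ 2) (-1) ⊓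 Qf.orthogonal N; let Miv : Submodule ℂ (TensorProduct ℚ ℂ (bettiCohomology Xs 2)) := Mv.baseChange ℂ ⊓ Module.End.eigenspace (A.baseChange ℂ) Complex.I; 6 ≤ Module.finrank ℂ Miv ∧ (∀ Γ' : Subgroup (bettiCohomology Xs 2 ≃ₗ[ℚ] bettiCohomology Xs 2), Γ' ≤ Γ → (Γ'.subgroupOf Γ).FiniteIndex → ∀ F : Submodule ℂ (TensorProduct ℚ ℂ (bettiCohomology Xs 2)), F ≤ Miv → (∀ γ ∈ Γ', ∀ x ∈ F, (γ.toLinearMap.baseChange ℂ) x ∈ F) → F = ⊥ ∨ F = Miv) ∧ N ≤ Module.End.eigenspace (A ^ 2) 1) → ∀ (γ : bettiCohomology (fiberOver π s₀) 2 ≃ₗ[ℚ] bettiCohomology (fiberOver π s₀) 2), γ ∈ ratMonodromyGroup π 2 hU ⟨s₀, Set.mem_univ s₀⟩ → (∃ a, pull (fiberOverEnd π τ hτπ s₀) 2 (pull (fiberOverEnd π τ hτπ s₀) 2 a) = -a ∧ γ a ≠ a) → ∀ (h : ComplexPoints (fiberOver π s₀) ≃ₜ ComplexPoints (fiberOver π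 s₀)), (∀ a, γ a = (singularCohomology.map ℚ ℚ (h : C(ComplexPoints (fiberOver π s₀), ComplexPoints (fiberOver π s₀))) 2).hom a) → singularHomology.map ℚ ℚ (h : C(ComplexPoints (fiberOver π s₀), ComplexPoints (fiberOver π s₀))) 4 (complexOrientationRat (hπ.isSmoothProjective s₀)).fundamentalClass = (complexOrientationRat (hπ.isSmoothProjective s₀)).fundamentalClass → ∀ (W₁ W₂ : Submodule ℚ (singularHomology ℚ ℚ (ComplexPoints (fiberOver π s₀)) 2)), Module.finrank ℚ W₁ ≤ 2 → (∀ w ∈ W₁, singularHomology.map ℚ ℚ (AlgPoints.mapContinuous (L := ℂ) (fiberOverEnd π τ hτπ s₀)) 2 w ∈ W₁) → (∀ w ∈ W₂, singularHomology.map ℚ ℚ (AlgPoints.mapContinuous (L := ℂ) (fiberOverEnd π τ hτπ s₀)) 2 w ∈ W₂) → (∀ w ∈ W₁, singularHomology.map ℚ ℚ (AlgPoints.mapContinuous (L := ℂ) (fiberOverEnd π τ hτπ s₀)) 2 (singularHomology.map ℚ ℚ (AlgPoints.mapContinuous (L := ℂ) (fiberOverEnd π τ hτπ s₀)) 2 w)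 = -w) → (∀ w ∈ W₂, singularHomology.map ℚ ℚ (AlgPoints.mapContinuous (L := ℂ) (fiberOverEnd π τ hτπ s₀)) 2 (singularHomology.map ℚ ℚ (AlgPoints.mapContinuous (L := ℂ) (fiberOverEnd π τ hτπ s₀)) 2 w) = -w) → (∀ w ∈ W₁, singularHomology.map ℚ ℚ (AlgPoints.mapContinuous (L := ℂ) (fiberOverEnd π j hjπ s₀)) 2 w ∈ W₂) → (∀ w ∈ W₂, singularHomology.map ℚ ℚ (AlgPoints.mapContinuous (L := ℂ) (fiberOverEnd π j hjπ s₀)) 2 w ∈ W₁) → (∀ y, singularHomology.map ℚ ℚ (AlgPoints.mapContinuous (L := ℂ) (fiberOverEnd π τ hτπ s₀)) 2 (singularHomology.map ℚ ℚ (AlgPoints.mapContinuous (L := ℂ) (fiberOverEnd π τ hτπ s₀)) 2 y) = -y → singularHomology.map ℚ ℚ (h : C(ComplexPoints (fiberOver π s₀), ComplexPoints (fiberOver π s₀))) 2 y - y ∈ W₁ ⊔ W₂) → (∀ w ∈ W₁, singularHomology.map ℚ ℚ (h : C(ComplexPoints (fiberOver π s₀), ComplexPoints (fiberOver π s₀)))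 2 w = singularHomology.map ℚ ℚ (AlgPoints.mapContinuous (L := ℂ) (fiberOverEnd π τ hτπ s₀)) 2 w) → (∀ w ∈ W₂, singularHomology.map ℚ ℚ (h : C(ComplexPoints (fiberOver π s₀), ComplexPoints (fiberOver π s₀))) 2 (singularHomology.map ℚ ℚ (AlgPoints.mapContinuous (L := ℂ) (fiberOverEnd π τ hτπ s₀)) 2 w) = w) → (∀ a b, poincareDualityMap (n := 4) (complexOrientationRat (hπ.isSmoothProjective s₀)) (show 2 + 2 = 4 by norm_num) a ∈ W₁ → poincareDualityMap (n := 4) (complexOrientationRat (hπ.isSmoothProjective s₀)) (show 2 + 2 = 4 by norm_num) b ∈ W₂ → tr (hπ.isSmoothProjective s₀) (2 + 2) (cup (fiberOver π s₀) 2 2 a b) = 0) → (∀ s : ComplexPoints (base W), let Xs := fiberOver π s; let hXs : IsSmoothProjective 2 Xs := hπ.isSmoothProjective s; let A : bettiCohomology Xs 2 →ₗ[ℚ] bettiCohomology Xs 2 := pull (fiberOverEnd π τ hτπ s) 2; let Qf : LinearMap.BilinForm ℚ (bettiCohomology Xs 2) := LinearMap.compr₂ (cup Xs 2 2) (tr hXs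 (2 + 2)); let Γ := ratMonodromyGroup π 2 hU ⟨s, Set.mem_univ s⟩; let N : Submodule ℚ (bettiCohomology Xs 2) := Submodule.span ℚ {x | ∃ Γ' : Subgroup (bettiCohomology Xs 2 ≃ₗ[ℚ] bettiCohomology Xs 2), Γ' ≤ Γ ∧ (Γ'.subgroupOf Γ).FiniteIndex ∧ ∀ γ ∈ Γ', γ x = x}; let Mv : Submodule ℚ (bettiCohomology Xs 2) := Module.End.eigenspace (A ^ 2) (-1) ⊓ Qf.orthogonal N; let Miv : Submodule ℂ (TensorProduct ℚ ℂ (bettiCohomology Xs 2)) := Mv.baseChange ℂ ⊓ Module.End.eigenspace (A.baseChange ℂ) Complex.I; Module.finrank ℂ ↥(Module.End.eigenspace ((A ^ 2).baseChange ℂ) 1 ⊓ (hodge exists_isReal_hodgeModel_holds hXs 2).piece 2 0) = 0 ∧ 0 < Module.finrank ℂ ↥(Module.End.eigenspace ((A ^ 2).baseChange ℂ) (-1) ⊓ (hodge exists_isReal_hodgeModel_holds hXs 2).piece 2 0) ∧ (N.baseChange ℂ ⊓ (hodge exists_isReal_hodgeModel_holds hXs 2).piece 2 0 = ⊥) ∧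 6 ≤ Module.finrank ℂ Miv ∧ (∀ Γ' : Subgroup (bettiCohomology Xs 2 ≃ₗ[ℚ] bettiCohomology Xs 2), Γ' ≤ Γ → (Γ'.subgroupOf Γ).FiniteIndex → ∀ F : Submodule ℂ (TensorProduct ℚ ℂ (bettiCohomology Xs 2)), F ≤ Miv → (∀ γ ∈ Γ', ∀ x ∈ F, (γ.toLinearMap.baseChange ℂ) x ∈ F) → F = ⊥ ∨ F = Miv) ∧ N ≤ Module.End.eigenspace (A ^ 2) 1) ∧ (∀ s : ComplexPoints (base W), let Xs := fiberOver π s; let hXs : IsSmoothProjective 2 Xs := hπ.isSmoothProjective s; let A : bettiCohomology Xs 2 →ₗ[ℚ] bettiCohomology Xs 2 := pull (fiberOverEnd π τ hτπ s) 2; let B : bettiCohomology Xs 2 →ₗ[ℚ] bettiCohomology Xs 2 := pull (fiberOverEnd π j hjπ s) 2; let Qf : LinearMap.BilinForm ℚ (bettiCohomology Xs 2) := LinearMap.compr₂ (cup Xs 2 2) (tr hXs (2 + 2)); let Γ := ratMonodromyGroup π 2 hU ⟨s, Set.mem_univ s⟩; ∃ γ ∈ Γ, ∃ ℓp ℓm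 : TensorProduct ℚ ℂ (bettiCohomology Xs 2), ℓp ∈ (Module.End.eigenspace (A ^ 2) (-1)).baseChange ℂ ∧ ℓm ∈ (Module.End.eigenspace (A ^ 2) (-1)).baseChange ℂ ∧ A.baseChange ℂ ℓp = Complex.I • ℓp ∧ A.baseChange ℂ ℓm = Complex.I • ℓm ∧ (Qf.baseChange ℂ) ℓp (B.baseChange ℂ ℓm) ≠ 0 ∧ (γ.toLinearMap.baseChange ℂ) ℓp = Complex.I • ℓp ∧ (γ.toLinearMap.baseChange ℂ) ℓm = (-Complex.I) • ℓm ∧ ∀ x ∈ (Module.End.eigenspace (A ^ 2) (-1)).baseChange ℂ, A.baseChange ℂ x = Complex.I • x → (Qf.baseChange ℂ) x (B.baseChange ℂ ℓp) = 0 → (Qf.baseChange ℂ) x (B.baseChange ℂ ℓm) = 0 → (γ.toLinearMap.baseChange ℂ) x = x) := by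
  intro e he h4 W 𝒳 π τ j ι hne hπ hqp hqpW hsm hτπ hjπ hτ4 hj2 hτjτ hιo hιπ hιτ hιj hsurj hU s₀ ho h0 γ hγΓ hγ1 h hγh hhμ W₁ W₂ hW₁ htW₁ htW₂ htt₁ htt₂ hjW₁ hjW₂ hvar hh₁ hh₂ horth
  have h5 := monodromyBireflection_at_member_of_twoBallDatum_ker π τ j hπ hqp hqpW hτπ hjπ hτ4 hj2 hτjτ hU s₀ γ hγΓ hγ1 h hγh hhμ
    W₁ W₂ hW₁ htW₁ htW₂ htt₁ htt₂ hjW₁ hjW₂ hvar hh₁ hh₂ horth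
  exact certifiedDeckFamily_clauses_of_member he h4 W 𝒳 π τ j ι hne hπ hqp hqpW hsm hτπ hjπ hτ4 hj2 hτjτ hιo hιπ hιτ hιj hsurj hU s₀ ho h0 h5

/-- **S9 from ONE member, the S5 input = the LOCAL CONFIGURATION of a monodromy homeomorphism at `s₀` (model-free homological form,
prover-Ax's `monodromyBireflection_of_localConfiguration`, p730948).** For every even `e ≥ 4`, every deck-family package of S6, `hU`
and ONE member `s₀`: the Hodge counts (o)(o′) at `s₀`, the monodromy clauses (ii)((iii))(iv) at `s₀`, and — on `X = X_{s₀}(ℂ)` — a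
monodromy transformation `γ ∈ Γ_{s₀}` moving some `a₀ ∈ ker(A² + 1)`, realised by a homeomorphism `h` (`h^* = γ`, `h_*[X] = [X]`)
commuting with `τ_{s₀}(ℂ)`, open pieces `A₁, A₂, B` (`A₁ ∪ A₂ ∪ B = X`, `closure A₁ ∩ A₂ = ∅`, `h = id` on `B`, `h` and `τ` preserve
`A_k`, `j` exchanges them, `H₂(A_k; ℚ)` finite-dimensional) and the local homological facts on the `τ|² = −1` part of `H₂(A_k; ℚ)`
(rank `≤ 2` on `A₁`, `h|_* = τ|_*` there on `A₁`, `h|_* τ|_* = 1` there on `A₂`) imply the S4-v6 body AND the S5-v6 body at EVERY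
member. Proof: Ax's theorem at `s₀`, then `certifiedDeckFamily_clauses_of_member` ((B′) + (ε)). What it leaves for S5: the EXISTENCE
of `(γ, h, A₁, A₂, B)` at one member of the model family (LOC6: L6-2 chart + L6-4a geometric local monodromy).
[cite: VoisinHodgeII2003, §3.1.2 and §3.2.1] [cite: ArnoldGuseinzadeVarchenko2012, Part I §1.1] [cite: Bredon1993, Ch. VI Thm. 11.10] -/
theorem certifiedDeckFamily_clauses_of_localConfiguration :
    open Literature.AlgebraicGeometry.Motives Literature.AlgebraicGeometry.HodgeTheory Literature.AlgebraicGeometry.HodgeTheory.BettiUniverse Literature.AlgebraicGeometry.HodgeTheory.Q8Family Literature.AlgebraicGeometry.RelativeSpec Literature.AlgebraicGeometry.RelativeSpec.ActionOver CategoryTheory CategoryTheory.Limits MonoidalCategory CartesianMonoidalCategory AlgebraicGeometry in ∀ ⦃e : ℕ⦄, Even e → 4 ≤ e → ∀ (W : (Spec (.of (ParamRing e))).Opens) (𝒳 : SchemeOver ℂ) (π : 𝒳 ⟶ base W) (τ j : 𝒳 ⟶ 𝒳) (ι : (deckChart (fun i => (MvPolynomial.X i : ParamRing e)) ⊗ Over.mk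 W.ι).left ⟶ 𝒳.left), Nonempty (ComplexPoints (base W)) → ∀ (hπ : IsSmoothProjectiveFamily π 2), IsQuasiProjectiveOver 𝒳 → IsQuasiProjectiveOver (base W) → AlgebraicGeometry.SmoothOfRelativeDimension (Fintype.card (CIdx e)) (base W).hom → ∀ (hτπ : τ ≫ π = π) (hjπ : j ≫ π = π), τ ≫ τ ≫ τ ≫ τ = 𝟙 𝒳 → j ≫ j = τ ≫ τ → τ ≫ j ≫ τ = j → IsOpenImmersion ι → ι ≫ π.left = (snd (deckChart (fun i => (MvPolynomial.X i : ParamRing e))) (Over.mk W.ι)).left → ((Over.isoMk ((deckAction (fun i => (MvPolynomial.X i : ParamRing e))).aut (QuaternionGroup.a 1)) ((deckAction (fun i => (MvPolynomial.X i : ParamRing e))).aut_comp (QuaternionGroup.a 1))).hom ▷ Over.mk W.ι).left ≫ ι = ι ≫ τ.left → ((Over.isoMk ((deckAction (fun i => (MvPolynomial.X i : ParamRing e))).aut (QuaternionGroup.xa 0)) ((deckAction (fun i => (MvPolynomial.X i : ParamRing e))).aut_comp (QuaternionGroup.xa 0))).hom ▷ Over.mk W.ι).left ≫ ι = ι ≫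 j.left → Function.Surjective (snd (deckChart (fun i => (MvPolynomial.X i : ParamRing e))) (Over.mk W.ι)).left → ∀ (hU : IsCohomologicallyLocallyTrivialOn π Set.univ) (s₀ : ComplexPoints (base W)), (let Xs := fiberOver π s₀; let hXs : IsSmoothProjective 2 Xs := hπ.isSmoothProjective s₀; let A : bettiCohomology Xs 2 →ₗ[ℚ] bettiCohomology Xs 2 := pull (fiberOverEnd π τ hτπ s₀) 2; Module.finrank ℂ ↥(Module.End.eigenspace ((A ^ 2).baseChange ℂ) 1 ⊓ (hodge exists_isReal_hodgeModel_holds hXs 2).piece 2 0) = 0 ∧ 0 < Module.finrank ℂ ↥(Module.End.eigenspace ((A ^ 2).baseChange ℂ) (-1) ⊓ (hodge exists_isReal_hodgeModel_holds hXs 2).piece 2 0)) → (let Xs := fiberOver π s₀; let hXs : IsSmoothProjective 2 Xs := hπ.isSmoothProjective s₀; let A : bettiCohomology Xs 2 →ₗ[ℚ] bettiCohomology Xs 2 := pull (fiberOverEnd π τ hτπ s₀) 2; let Qf : LinearMap.BilinForm ℚ (bettiCohomology Xs 2) := LinearMap.compr₂ (cup Xs 2 2) (tr hXs (2 + 2));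 let Γ := ratMonodromyGroup π 2 hU ⟨s₀, Set.mem_univ s₀⟩; let N : Submodule ℚ (bettiCohomology Xs 2) := Submodule.span ℚ {x | ∃ Γ' : Subgroup (bettiCohomology Xs 2 ≃ₗ[ℚ] bettiCohomology Xs 2), Γ' ≤ Γ ∧ (Γ'.subgroupOf Γ).FiniteIndex ∧ ∀ γ ∈ Γ', γ x = x}; let Mv : Submodule ℚ (bettiCohomology Xs 2) := Module.End.eigenspace (A ^ 2) (-1) ⊓ Qf.orthogonal N; let Miv : Submodule ℂ (TensorProduct ℚ ℂ (bettiCohomology Xs 2)) := Mv.baseChange ℂ ⊓ Module.End.eigenspace (A.baseChange ℂ) Complex.I; 6 ≤ Module.finrank ℂ Miv ∧ (∀ Γ' : Subgroup (bettiCohomology Xs 2 ≃ₗ[ℚ] bettiCohomology Xs 2), Γ' ≤ Γ → (Γ'.subgroupOf Γ).FiniteIndex → ∀ F : Submodule ℂ (TensorProduct ℚ ℂ (bettiCohomology Xs 2)), F ≤ Miv → (∀ γ ∈ Γ', ∀ x ∈ F, (γ.toLinearMap.baseChange ℂ) x ∈ F) → F = ⊥ ∨ F = Miv) ∧ N ≤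 Module.End.eigenspace (A ^ 2) 1) → ∀ (γ : bettiCohomology (fiberOver π s₀) 2 ≃ₗ[ℚ] bettiCohomology (fiberOver π s₀) 2), γ ∈ ratMonodromyGroup π 2 hU ⟨s₀, Set.mem_univ s₀⟩ → (∃ a, pull (fiberOverEnd π τ hτπ s₀) 2 (pull (fiberOverEnd π τ hτπ s₀) 2 a) = -a ∧ γ a ≠ a) → ∀ (h : ComplexPoints (fiberOver π s₀) ≃ₜ ComplexPoints (fiberOver π s₀)), (∀ a, γ a = (singularCohomology.map ℚ ℚ (h : C(ComplexPoints (fiberOver π s₀), ComplexPoints (fiberOver π s₀))) 2).hom a) → singularHomology.map ℚ ℚ (h : C(ComplexPoints (fiberOver π s₀), ComplexPoints (fiberOver π s₀))) 4 (complexOrientationRat (hπ.isSmoothProjective s₀)).fundamentalClass = (complexOrientationRat (hπ.isSmoothProjective s₀)).fundamentalClass → (∀ x, h ((AlgPoints.mapContinuous (L := ℂ) (fiberOverEnd π τ hτπ s₀)) x) = (AlgPoints.mapContinuous (L := ℂ) (fiberOverEnd π τ hτπ s₀)) (h x)) → ∀ ⦃A₁ A₂ B : Set (ComplexPoints (fiberOver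 π s₀))⦄, IsOpen A₁ → IsOpen A₂ → IsOpen B → A₁ ∪ A₂ ∪ B = Set.univ → Disjoint (closure A₁) A₂ → (∀ x ∈ B, h x = x) → ∀ (hhA₁ : Set.MapsTo (h : C(ComplexPoints (fiberOver π s₀), ComplexPoints (fiberOver π s₀))) A₁ A₁) (hhA₂ : Set.MapsTo (h : C(ComplexPoints (fiberOver π s₀), ComplexPoints (fiberOver π s₀))) A₂ A₂) (hτA₁ : Set.MapsTo (AlgPoints.mapContinuous (L := ℂ) (fiberOverEnd π τ hτπ s₀)) A₁ A₁) (hτA₂ : Set.MapsTo (AlgPoints.mapContinuous (L := ℂ) (fiberOverEnd π τ hτπ s₀)) A₂ A₂), Set.MapsTo (AlgPoints.mapContinuous (L := ℂ) (fiberOverEnd π j hjπ s₀)) A₁ A₂ → Set.MapsTo (AlgPoints.mapContinuous (L := ℂ) (fiberOverEnd π j hjπ s₀)) A₂ A₁ → ∀ [Module.Finite ℚ (singularHomology ℚ ℚ (↥A₁) 2)] [Module.Finite ℚ (singularHomology ℚ ℚ (↥A₂) 2)], Module.finrank ℚ ↥(Module.End.eigenspace ((singularHomology.map ℚ ℚ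 (singularHomology.restrictSelf (AlgPoints.mapContinuous (L := ℂ) (fiberOverEnd π τ hτπ s₀)) hτA₁) 2).hom ^ 2) (-1 : ℚ)) ≤ 2 → (∀ a : singularHomology ℚ ℚ (↥A₁) 2, singularHomology.map ℚ ℚ (singularHomology.restrictSelf (AlgPoints.mapContinuous (L := ℂ) (fiberOverEnd π τ hτπ s₀)) hτA₁) 2 (singularHomology.map ℚ ℚ (singularHomology.restrictSelf (AlgPoints.mapContinuous (L := ℂ) (fiberOverEnd π τ hτπ s₀)) hτA₁) 2 a) = -a → singularHomology.map ℚ ℚ (singularHomology.restrictSelf (h : C(ComplexPoints (fiberOver π s₀), ComplexPoints (fiberOver π s₀))) hhA₁) 2 a = singularHomology.map ℚ ℚ (singularHomology.restrictSelf (AlgPoints.mapContinuous (L := ℂ) (fiberOverEnd π τ hτπ s₀)) hτA₁) 2 a) → (∀ a : singularHomology ℚ ℚ (↥A₂) 2, singularHomology.map ℚ ℚ (singularHomology.restrictSelf (AlgPoints.mapContinuous (L := ℂ) (fiberOverEnd π τ hτπ s₀)) hτA₂) 2 (singularHomology.map ℚ ℚ (singularHomology.restrictSelf (AlgPoints.mapContinuous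 (L := ℂ) (fiberOverEnd π τ hτπ s₀)) hτA₂) 2 a) = -a → singularHomology.map ℚ ℚ (singularHomology.restrictSelf (h : C(ComplexPoints (fiberOver π s₀), ComplexPoints (fiberOver π s₀))) hhA₂) 2 (singularHomology.map ℚ ℚ (singularHomology.restrictSelf (AlgPoints.mapContinuous (L := ℂ) (fiberOverEnd π τ hτπ s₀)) hτA₂) 2 a) = a) → (∀ s : ComplexPoints (base W), let Xs := fiberOver π s; let hXs : IsSmoothProjective 2 Xs := hπ.isSmoothProjective s; let A : bettiCohomology Xs 2 →ₗ[ℚ] bettiCohomology Xs 2 := pull (fiberOverEnd π τ hτπ s) 2; let Qf : LinearMap.BilinForm ℚ (bettiCohomology Xs 2) := LinearMap.compr₂ (cup Xs 2 2) (tr hXs (2 + 2)); let Γ := ratMonodromyGroup π 2 hU ⟨s, Set.mem_univ s⟩; let N : Submodule ℚ (bettiCohomology Xs 2) := Submodule.span ℚ {x | ∃ Γ' : Subgroup (bettiCohomology Xs 2 ≃ₗ[ℚ] bettiCohomology Xs 2), Γ' ≤ Γ ∧ (Γ'.subgroupOf Γ).FiniteIndex ∧ ∀ γ ∈ Γ',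 γ x = x}; let Mv : Submodule ℚ (bettiCohomology Xs 2) := Module.End.eigenspace (A ^ 2) (-1) ⊓ Qf.orthogonal N; let Miv : Submodule ℂ (TensorProduct ℚ ℂ (bettiCohomology Xs 2)) := Mv.baseChange ℂ ⊓ Module.End.eigenspace (A.baseChange ℂ) Complex.I; Module.finrank ℂ ↥(Module.End.eigenspace ((A ^ 2).baseChange ℂ) 1 ⊓ (hodge exists_isReal_hodgeModel_holds hXs 2).piece 2 0) = 0 ∧ 0 < Module.finrank ℂ ↥(Module.End.eigenspace ((A ^ 2).baseChange ℂ) (-1) ⊓ (hodge exists_isReal_hodgeModel_holds hXs 2).piece 2 0) ∧ (N.baseChange ℂ ⊓ (hodge exists_isReal_hodgeModel_holds hXs 2).piece 2 0 = ⊥) ∧ 6 ≤ Module.finrank ℂ Miv ∧ (∀ Γ' : Subgroup (bettiCohomology Xs 2 ≃ₗ[ℚ] bettiCohomology Xs 2), Γ' ≤ Γ → (Γ'.subgroupOf Γ).FiniteIndex → ∀ F : Submodule ℂ (TensorProduct ℚ ℂ (bettiCohomology Xs 2)), F ≤ Miv → (∀ γ ∈ Γ', ∀ x ∈ F, (γ.toLinearMap.baseChange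 ℂ) x ∈ F) → F = ⊥ ∨ F = Miv) ∧ N ≤ Module.End.eigenspace (A ^ 2) 1) ∧ (∀ s : ComplexPoints (base W), let Xs := fiberOver π s; let hXs : IsSmoothProjective 2 Xs := hπ.isSmoothProjective s; let A : bettiCohomology Xs 2 →ₗ[ℚ] bettiCohomology Xs 2 := pull (fiberOverEnd π τ hτπ s) 2; let B : bettiCohomology Xs 2 →ₗ[ℚ] bettiCohomology Xs 2 := pull (fiberOverEnd π j hjπ s) 2; let Qf : LinearMap.BilinForm ℚ (bettiCohomology Xs 2) := LinearMap.compr₂ (cup Xs 2 2) (tr hXs (2 + 2)); let Γ := ratMonodromyGroup π 2 hU ⟨s, Set.mem_univ s⟩; ∃ γ ∈ Γ, ∃ ℓp ℓm : TensorProduct ℚ ℂ (bettiCohomology Xs 2), ℓp ∈ (Module.End.eigenspace (A ^ 2) (-1)).baseChange ℂ ∧ ℓm ∈ (Module.End.eigenspace (A ^ 2) (-1)).baseChange ℂ ∧ A.baseChange ℂ ℓp = Complex.I • ℓp ∧ A.baseChange ℂ ℓm = Complex.I • ℓm ∧ (Qf.baseChange ℂ) ℓp (B.baseChange ℂ ℓm)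 ≠ 0 ∧ (γ.toLinearMap.baseChange ℂ) ℓp = Complex.I • ℓp ∧ (γ.toLinearMap.baseChange ℂ) ℓm = (-Complex.I) • ℓm ∧ ∀ x ∈ (Module.End.eigenspace (A ^ 2) (-1)).baseChange ℂ, A.baseChange ℂ x = Complex.I • x → (Qf.baseChange ℂ) x (B.baseChange ℂ ℓp) = 0 → (Qf.baseChange ℂ) x (B.baseChange ℂ ℓm) = 0 → (γ.toLinearMap.baseChange ℂ) x = x) := by
  intro e he h4 W 𝒳 π τ j ι hne hπ hqp hqpW hsm hτπ hjπ hτ4 hj2 hτjτ hιo hιπ hιτ hιj hsurj hU s₀ ho h0 γ hγΓ hγ1 h hγh hhμ hhτ A₁ A₂ B h1o h2o hBo hcov hdisj hB hhA₁ hhA₂ hτA₁ hτA₂ hjA₁ hjA₂ hf₁ hf₂ hrank₁ hloc₁ hloc₂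
  have h5 := monodromyBireflection_of_localConfiguration π hτπ hπ hqp hqpW hjπ hτ4 hj2 hτjτ hU s₀ γ hγΓ hγ1 h hγh hhμ hhτ h1o h2o hBo
    hcov hdisj hB hhA₁ hhA₂ hτA₁ hτA₂ hjA₁ hjA₂ hrank₁ hloc₁ hloc₂
  exact certifiedDeckFamily_clauses_of_member he h4 W 𝒳 π τ j ι hne hπ hqp hqpW hsm hτπ hjπ hτ4 hj2 hτjτ hιo hιπ hιτ hιj hsurj hU s₀ ho h0 h5

end Summit.HodgeConjecture.HodgeConjecture.Theorems.Q8SymplecticPowersCertifiedDeckFamilyOfKerDatum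

end
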